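import Summits.Ventures.CertifiedManyBodySolver.Upper.DWaveSourceOpenClusterTrialRows
import HarnessLib

/-!
# Cluster trial states for the pinning-field rows, part 6: the `t–t'` twin — diagonal hopping inside the
# open cluster, the block cut of the diagonal graph, and the cap / rows for `dWaveSourceTorusTT'`

HONEST FRAMING: first certified bounds; not a superconductivity verdict; every number certified or
labelled float. Nothing in this file is a number: it is a soundness edge (cluster trial state ⇒ energy CEILING)
for the `t–t'` pair-sourced torus (the cuprate anchor `t' = −1/4` of CQ-TABLE §A0 as much as `t' = 0`).

Companion of parts 1–5 (seat hubbard-obs-pin-1). The sourced `t–t'` torus is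
`dWaveSourceTorusTT' L tp U μ h = dWaveSourceTorus L U μ h + hamiltonian (fermionTorusDiagGraph L) tp 0`
(tree `dWaveSourceTorusTT'_eq_dWaveSourceTorus_add`). The diagonal (next-nearest-neighbour) hopping is a
one-graph Hubbard Hamiltonian with `U = 0`, so the SAME block cut (`sourced_sub_sum_jwEmbed_sub_onSiteSum_eq` with
no source) and the SAME parity bookkeeping apply, once the diagonal no-wrap lemma is in place:

* `fermionTorusDiagGraph_adj_blockSite_iff` (`a, b < L`): diagonal torus adjacency of two sites of one block is
  the open-box diagonal adjacency `rectBoxDiagGraph a b` (steps `(±1, ±1)`, `|eᵢ| ≤ 1`, part 2's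
  `toTorusSite_blockSite_eq_add_proj_iff`);
* `dWaveSourceOpenBoxTT' a b tp U μ h := dWaveSourceOpenBox a b U μ h + hamiltonian (rectBoxDiagGraph a b) tp 0`
  — the open `t–t'` cluster with the `d`-wave source (at `tp = 0` the part-3 cluster; its `U`-free diagonal part
  is the tree's `hubbardOpenBoxTT' a b 1 tp U` minus the nearest-neighbour part);
* `hamiltonian_fermionTorusDiagGraph_sub_sum_jwEmbed_eq` (block cut of the diagonal hopping),
  `expect_prodFamily_hamiltonian_fermionTorusDiagGraph`, **`expect_prodFamily_dWaveSourceTorusTT'`**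
  (`⟨⊗_R φ, A^{tt'}_L ⊗_R φ⟩ = Kx Ky ⟨φ, A^{tt'}_C φ⟩`), the bound
  **`groundEnergy_dWaveSourceTorusTT'_le_div_mul_sq`**, the ROWS `sourcedTorusEnergyUpperRow_of_clusterStateTT'`
  / **`sourcedEnergyUpperRow_of_clusterStateTT'`** / `…_of_exists_clusterStateTT'` (`SourcedEnergyUpperRow tp U μ h
  q L₀ e` at every real `tp`), and the `hrows` shape at general `tp`: `periodicTrialRows_of_clusterStateTT'[_rat]`.

References: D. Ruelle, *Statistical Mechanics: Rigorous Results* (1969) §3.3; H. Xu et al., Science 384 (2024)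
eadh7691, eq. (1) (the `t–t'` Hamiltonian); T. Koma, H. Tasaki, J. Stat. Phys. 76 (1994) 745, §1. Tree: parts 1–5,
`fermionTorusDiagGraph` / `torusDiagGraph` / `torusDiagJump` (`HubbardNNNHopping`), `rectBoxDiagGraph`
(`HubbardNNNHoppingOpenClusters`), `isParityPreserving_hamiltonian`.
-/

noncomputable section

namespace Summit.Ventures.CertifiedManyBodySolver

open Matrix Literature.Probability.LatticeModels
open Literature.MathematicalPhysics.QuantumLattice Literature.MathematicalPhysics.QuantumLattice.ThermodynamicLimit
open Literature.MathematicalPhysics.QuantumLattice.TwoCluster Literature.Barriers.HubbardSuperconductivity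
open TorusRectBlock ClusterParity
open scoped ComplexOrder

/-! ### The diagonal no-wrap lemma -/

namespace TorusRectBlock

variable {L Kx Ky a b : ℕ} (hLa : L = Kx * a) (hLb : L = Ky * b)

/-- The integer diagonal steps `(1, 1)` (`s = 0`) and `(1, −1)` (`s = 1`) of `ℤ²`. [folklore] -/
def diagStep (s : Fin 2) : Site 2 := fun i => if i = 0 then 1 else if s = 0 then 1 else -1

/-- The diagonal steps project to the tree's `torusDiagJump`. [folklore] -/
theorem proj_diagStep (s : Fin 2) : Torus.proj L (diagStep s) = torusDiagJump L s := by
  funext i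
  change (((diagStep s) i : ℤ) : ZMod L) = torusDiagJump L s i
  simp only [diagStep, torusDiagJump]
  split_ifs <;> simp

/-- The diagonal steps have entries bounded by one. [folklore] -/
theorem abs_diagStep_apply_le (s i : Fin 2) : |diagStep s i| ≤ 1 := by
  simp only [diagStep]
  split_ifs <;> simp

/-- `diagStep s 0 = 1`. [folklore] -/
theorem diagStep_zero (s : Fin 2) : diagStep s 0 = 1 := by simp [diagStep]

/-- `diagStep 0 1 = 1`. [folklore] -/
theorem diagStep_zero_one : diagStep 0 1 = 1 := by simp [diagStep]

/-- `diagStep 1 1 = −1`. [folklore] -/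
theorem diagStep_one_one : diagStep 1 1 = -1 := by simp [diagStep]

/-- **Diagonal torus adjacency of two sites of one block is open-box diagonal adjacency** (`a, b < L`).
[cite: Ruelle1969, §3.3] -/
theorem fermionTorusDiagGraph_adj_blockSite_iff (haL : a < L) (hbL : b < L) (R : Fin Kx ×ₗ Fin Ky)
    (p q : Fin a ×ₗ Fin b) :
    (fermionTorusDiagGraph L).Adj (blockSite hLa hLb R p) (blockSite hLa hLb R q) ↔ (rectBoxDiagGraph a b).Adj p q := by
  have step : ∀ (p q : Fin a ×ₗ Fin b) (s : Fin 2),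
      FermionTorus.toTorusSite (blockSite hLa hLb R q) =
          FermionTorus.toTorusSite (blockSite hLa hLb R p) + torusDiagJump L s ↔
        ((((ofLex q).1 : ℕ) : ℤ) = (((ofLex p).1 : ℕ) : ℤ) + diagStep s 0 ∧
          (((ofLex q).2 : ℕ) : ℤ) = (((ofLex p).2 : ℕ) : ℤ) + diagStep s 1) := by
    intro p q s
    rw [← proj_diagStep, toTorusSite_blockSite_eq_add_proj_iff hLa hLb haL hbL R p q (abs_diagStep_apply_le s)]
  -- integer form of the diagonal torus adjacency
  have htorus : (fermionTorusDiagGraph L).Adj (blockSite hLa hLb R p) (blockSite hLa hLb R q) ↔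
      (((((ofLex q).1 : ℕ) : ℤ) = (((ofLex p).1 : ℕ) : ℤ) + 1 ∧ (((ofLex q).2 : ℕ) : ℤ) = (((ofLex p).2 : ℕ) : ℤ) + 1) ∨
       ((((ofLex q).1 : ℕ) : ℤ) = (((ofLex p).1 : ℕ) : ℤ) + 1 ∧ (((ofLex q).2 : ℕ) : ℤ) = (((ofLex p).2 : ℕ) : ℤ) - 1) ∨
       ((((ofLex p).1 : ℕ) : ℤ) = (((ofLex q).1 : ℕ) : ℤ) + 1 ∧ (((ofLex p).2 : ℕ) : ℤ) = (((ofLex q).2 : ℕ) : ℤ) + 1) ∨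
       ((((ofLex p).1 : ℕ) : ℤ) = (((ofLex q).1 : ℕ) : ℤ) + 1 ∧ (((ofLex p).2 : ℕ) : ℤ) = (((ofLex q).2 : ℕ) : ℤ) - 1)) := by
    change (torusDiagGraph L).Adj (FermionTorus.toTorusSite (blockSite hLa hLb R p))
      (FermionTorus.toTorusSite (blockSite hLa hLb R q)) ↔ _
    rw [torusDiagGraph, SimpleGraph.fromRel_adj]
    constructor
    · rintro ⟨-, ⟨s, hs⟩ | ⟨s, hs⟩⟩
      · obtain ⟨h0, h1⟩ := (step p q s).1 hs
        rw [diagStep_zero] at h0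
        rcases Fin.eq_zero_or_eq_succ s with hs0 | ⟨k, hk⟩
        · subst hs0
          rw [diagStep_zero_one] at h1
          exact Or.inl ⟨h0, h1⟩
        · have hk0 : k = 0 := Fin.eq_zero k
          subst hk0
          have hs1 : s = 1 := by rw [hk]; rfl
          subst hs1
          rw [diagStep_one_one] at h1
          exact Or.inr (Or.inl ⟨h0, by linarith⟩)
      · obtain ⟨h0, h1⟩ := (step q p s).1 hs
        rw [diagStep_zero] at h0
        rcases Fin.eq_zero_or_eq_succ s with hs0 | ⟨k, hk⟩
        · subst hs0
          rw [diagStep_zero_one] at h1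
          exact Or.inr (Or.inr (Or.inl ⟨h0, h1⟩))
        · have hk0 : k = 0 := Fin.eq_zero k
          subst hk0
          have hs1 : s = 1 := by rw [hk]; rfl
          subst hs1
          rw [diagStep_one_one] at h1
          exact Or.inr (Or.inr (Or.inr ⟨h0, by linarith⟩))
    · intro h
      -- a diagonal step never fixes a site
      have hne : ∀ (p q : Fin a ×ₗ Fin b) (s : Fin 2),
          FermionTorus.toTorusSite (blockSite hLa hLb R q) =
            FermionTorus.toTorusSite (blockSite hLa hLb R p) + torusDiagJump L s →
          FermionTorus.toTorusSite (blockSite hLa hLb R p) ≠ FermionTorus.toTorusSite (blockSite hLa hLb R q) := by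
        intro p q s hs heq
        rw [heq] at hs
        obtain ⟨h0, -⟩ := (step q q s).1 hs
        rw [diagStep_zero] at h0
        linarith
      rcases h with ⟨h0, h1⟩ | ⟨h0, h1⟩ | ⟨h0, h1⟩ | ⟨h0, h1⟩
      · have hs := (step p q 0).2 ⟨by rw [diagStep_zero]; exact h0, by rw [diagStep_zero_one]; exact h1⟩
        exact ⟨hne p q 0 hs, Or.inl ⟨0, hs⟩⟩
      · have hs := (step p q 1).2 ⟨by rw [diagStep_zero]; exact h0, by rw [diagStep_one_one]; linarith⟩
        exact ⟨hne p q 1 hs, Or.inl ⟨1, hs⟩⟩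
      · have hs := (step q p 0).2 ⟨by rw [diagStep_zero]; exact h0, by rw [diagStep_zero_one]; exact h1⟩
        exact ⟨(hne q p 0 hs).symm, Or.inr ⟨0, hs⟩⟩
      · have hs := (step q p 1).2 ⟨by rw [diagStep_zero]; exact h0, by rw [diagStep_one_one]; linarith⟩
        exact ⟨(hne q p 1 hs).symm, Or.inr ⟨1, hs⟩⟩
  rw [htorus]
  change _ ↔ (lineAdj ((ofLex p).1 : ℕ) ((ofLex q).1 : ℕ) ∧ lineAdj ((ofLex p).2 : ℕ) ((ofLex q).2 : ℕ))
  simp only [lineAdj]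
  omega

end TorusRectBlock

/-! ### The open `t–t'` sourced cluster and the block cut of the diagonal hopping -/

/-- **The open `a × b` `t–t'` Hubbard cluster with the `d`-wave pair source**:
`A^{tt'}_C = dWaveSourceOpenBox a b U μ h + hamiltonian (rectBoxDiagGraph a b) tp 0` (diagonal hopping `tp` on
the box diagonals, no periodic bonds). [cite: XuEtAl2024, eq. (1)] -/
def dWaveSourceOpenBoxTT' (a b : ℕ) (tp U μ h : ℝ) :
    Matrix (Finset (Orb (Fin a ×ₗ Fin b))) (Finset (Orb (Fin a ×ₗ Fin b))) ℂ :=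
  dWaveSourceOpenBox a b U μ h + hamiltonian (rectBoxDiagGraph a b) tp 0

/-- At `tp = 0` the `t–t'` cluster is the part-3 cluster. [folklore] -/
@[simp] theorem dWaveSourceOpenBoxTT'_zero_tp (a b : ℕ) (U μ h : ℝ) :
    dWaveSourceOpenBoxTT' a b 0 U μ h = dWaveSourceOpenBox a b U μ h := by
  rw [dWaveSourceOpenBoxTT']
  simp [hamiltonian]

/-- The `t–t'` sourced cluster is Hermitian. [cite: XuEtAl2024, eq. (1)] -/
theorem dWaveSourceOpenBoxTT'_isHermitian (a b : ℕ) (tp U μ h : ℝ) : (dWaveSourceOpenBoxTT' a b tp U μ h).IsHermitian :=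
  (dWaveSourceOpenBox_isHermitian a b U μ h).add (hamiltonian_isHermitian_and_commute_holds (rectBoxDiagGraph a b) tp 0).1

/-- The `t–t'` sourced cluster is even. [folklore] -/
theorem isParityPreserving_dWaveSourceOpenBoxTT' (a b : ℕ) (tp U μ h : ℝ) :
    IsParityPreserving (dWaveSourceOpenBoxTT' a b tp U μ h) :=
  (isParityPreserving_dWaveSourceOpenBox a b U μ h).add (isParityPreserving_hamiltonian _ tp 0)

section Cut

variable {L Kx Ky a b : ℕ} (hLa : L = Kx * a) (hLb : L = Ky * b)

/-- **Block cut of the diagonal hopping** (`a, b < L`): the diagonal torus hopping minus the embedded open-box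
diagonal hoppings is minus the inter-block diagonal bonds. [cite: Ruelle1969, §3.3] -/
theorem hamiltonian_fermionTorusDiagGraph_sub_sum_jwEmbed_eq [NeZero L] (haL : a < L) (hbL : b < L) (tp : ℝ) :
    hamiltonian (fermionTorusDiagGraph L) tp 0 -
        ∑ R : Fin Kx ×ₗ Fin Ky, jwEmbed (blockOrbEmb hLa hLb R) (hamiltonian (rectBoxDiagGraph a b) tp 0) =
      -(∑ bd ∈ (Finset.univ.biUnion fun R : Fin Kx ×ₗ Fin Ky =>
            (Finset.univ : Finset (Bond (Fin a ×ₗ Fin b))).map ⟨bondMap (blockSiteEmb hLa hLb R), bondMap_injective _⟩)ᶜ,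
          hubbardCoupling (fermionTorusDiagGraph L) ((tp : ℝ) : ℂ) bd • bondOp bd) := by
  have hcut := sourced_sub_sum_jwEmbed_sub_onSiteSum_eq (Finset.univ : Finset (Fin Kx ×ₗ Fin Ky))
    (blockSiteEmb hLa hLb) (fun R _ R' _ hne x y => blockSite_ne_of_ne hLa hLb hne x y)
    (fermionTorusDiagGraph L) (rectBoxDiagGraph a b)
    (fun R _ x y => (fermionTorusDiagGraph_adj_blockSite_iff hLa hLb haL hbL R x y).symm) tp 0 0 0
    (fun _ => 0) (fun _ => 0) (fun _ _ _ => rfl)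
  have hrest : onSiteSum ((0 : ℝ) : ℂ) ((0 : ℝ) : ℂ) (Finset.univ.biUnion fun R : Fin Kx ×ₗ Fin Ky =>
      (Finset.univ : Finset (Fin a ×ₗ Fin b)).map (blockSiteEmb hLa hLb R).toEmbedding)ᶜ = 0 := by
    rw [biUnion_map_blockSiteEmb_eq_univ, Finset.compl_univ, onSiteSum, Finset.sum_empty]
  simp only [Complex.ofReal_zero, zero_smul, Finset.sum_const_zero, conjTranspose_zero, add_zero, smul_zero,
    sub_zero, hamiltonianWith_zero] at hcut hrest
  rw [hrest, sub_zero] at hcut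
  exact hcut

/-- **Expectation of the diagonal hopping in the tiled product of an even unit cluster vector**:
`⟨⊗_R φ, H'_L ⊗_R φ⟩ = Kx Ky ⟨φ, H'_C φ⟩`. [cite: Ruelle1969, §3.3] -/
theorem expect_prodFamily_hamiltonian_fermionTorusDiagGraph [NeZero L] (haL : a < L) (hbL : b < L) (tp : ℝ)
    {φ : Fock (Orb (Fin a ×ₗ Fin b))} (hφ : HasParity 0 φ) (hφ1 : star φ ⬝ᵥ φ = 1) :
    star ((rectBlockPartition hLa hLb).prodFamily fun _ => φ) ⬝ᵥ
        (hamiltonian (fermionTorusDiagGraph L) tp 0 *ᵥ (rectBlockPartition hLa hLb).prodFamily fun _ => φ) =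
      ((Kx * Ky : ℕ) : ℂ) * (star φ ⬝ᵥ (hamiltonian (rectBoxDiagGraph a b) tp 0 *ᵥ φ)) := by
  have hpar : ∀ R : Fin Kx ×ₗ Fin Ky, HasParity ((fun _ => 0) R) ((fun _ => φ) R) := fun _ => hφ
  have hcut := hamiltonian_fermionTorusDiagGraph_sub_sum_jwEmbed_eq hLa hLb haL hbL tp
  rw [sub_eq_iff_eq_add'] at hcut
  rw [hcut]
  have hblock : ∀ R : Fin Kx ×ₗ Fin Ky,
      star ((rectBlockPartition hLa hLb).prodFamily fun _ => φ) ⬝ᵥ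
        (jwEmbed (blockOrbEmb hLa hLb R) (hamiltonian (rectBoxDiagGraph a b) tp 0) *ᵥ
          (rectBlockPartition hLa hLb).prodFamily fun _ => φ) =
        star φ ⬝ᵥ (hamiltonian (rectBoxDiagGraph a b) tp 0 *ᵥ φ) := fun R =>
    star_prodFamily_dotProduct_jwEmbed_eq (rectBlockPartition hLa hLb)
      (isParityPreserving_hamiltonian _ tp 0) R (fun _ => hφ1)
  have hbond : ∀ bd ∈ (Finset.univ.biUnion fun R : Fin Kx ×ₗ Fin Ky =>
      (Finset.univ : Finset (Bond (Fin a ×ₗ Fin b))).map ⟨bondMap (blockSiteEmb hLa hLb R), bondMap_injective _⟩)ᶜ,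
      star ((rectBlockPartition hLa hLb).prodFamily fun _ => φ) ⬝ᵥ
        (bondOp bd *ᵥ (rectBlockPartition hLa hLb).prodFamily fun _ => φ) = 0 := fun bd hbd =>
    star_prodFamily_dotProduct_hop_eq_zero hLa hLb hpar (blockOf_ne_of_not_mem_bonds hLa hLb (Finset.mem_compl.1 hbd)) _ _
  have hB : star ((rectBlockPartition hLa hLb).prodFamily fun _ => φ) ⬝ᵥ
      ((∑ R : Fin Kx ×ₗ Fin Ky, jwEmbed (blockOrbEmb hLa hLb R) (hamiltonian (rectBoxDiagGraph a b) tp 0)) *ᵥ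
        (rectBlockPartition hLa hLb).prodFamily fun _ => φ) =
      ((Kx * Ky : ℕ) : ℂ) * (star φ ⬝ᵥ (hamiltonian (rectBoxDiagGraph a b) tp 0 *ᵥ φ)) := by
    rw [Matrix.sum_mulVec, dotProduct_sum, Finset.sum_congr rfl fun R _ => hblock R, Finset.sum_const,
      Finset.card_univ, card_blocks, nsmul_eq_mul]
  have hS : star ((rectBlockPartition hLa hLb).prodFamily fun _ => φ) ⬝ᵥ
      ((∑ bd ∈ (Finset.univ.biUnion fun R : Fin Kx ×ₗ Fin Ky =>
          (Finset.univ : Finset (Bond (Fin a ×ₗ Fin b))).map ⟨bondMap (blockSiteEmb hLa hLb R), bondMap_injective _⟩)ᶜ,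
        hubbardCoupling (fermionTorusDiagGraph L) ((tp : ℝ) : ℂ) bd • bondOp bd) *ᵥ
        (rectBlockPartition hLa hLb).prodFamily fun _ => φ) = 0 := by
    rw [Matrix.sum_mulVec, dotProduct_sum]
    exact Finset.sum_eq_zero fun bd hbd => by rw [Matrix.smul_mulVec, dotProduct_smul, hbond bd hbd, smul_zero]
  rw [add_mulVec, dotProduct_add, hB, neg_mulVec, dotProduct_neg, hS, neg_zero, add_zero]

/-- **The expectation of the `t–t'` sourced torus in the tiled product of an even unit cluster vector**:
`⟨⊗_R φ, A^{tt'}_L ⊗_R φ⟩ = Kx Ky ⟨φ, A^{tt'}_C φ⟩` (`L = Kx a = Ky b`, `a, b < L`). [cite: Ruelle1969, §3.3] -/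
theorem expect_prodFamily_dWaveSourceTorusTT' [NeZero L] (haL : a < L) (hbL : b < L) (tp U μ h : ℝ)
    {φ : Fock (Orb (Fin a ×ₗ Fin b))} (hφ : HasParity 0 φ) (hφ1 : star φ ⬝ᵥ φ = 1) :
    star ((rectBlockPartition hLa hLb).prodFamily fun _ => φ) ⬝ᵥ
        (dWaveSourceTorusTT' L tp U μ h *ᵥ (rectBlockPartition hLa hLb).prodFamily fun _ => φ) =
      ((Kx * Ky : ℕ) : ℂ) * (star φ ⬝ᵥ (dWaveSourceOpenBoxTT' a b tp U μ h *ᵥ φ)) := by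
  rw [dWaveSourceTorusTT'_eq_dWaveSourceTorus_add, dWaveSourceOpenBoxTT', add_mulVec, dotProduct_add,
    add_mulVec, dotProduct_add, expect_prodFamily_dWaveSourceTorus hLa hLb haL hbL U μ h hφ hφ1,
    expect_prodFamily_hamiltonian_fermionTorusDiagGraph hLa hLb haL hbL tp hφ hφ1, mul_add]

/-- **Cluster variational principle for the `t–t'` pair-sourced torus**:
`E₀(dWaveSourceTorusTT' L tp U μ h) ≤ Kx Ky · Re⟨φ, A^{tt'}_C φ⟩`. [cite: Ruelle1969, §3.3] -/
theorem groundEnergy_dWaveSourceTorusTT'_le_mul_expect_openBox [NeZero L] (hLa : L = Kx * a) (hLb : L = Ky * b)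
    (haL : a < L) (hbL : b < L) (tp U μ h : ℝ) {φ : Fock (Orb (Fin a ×ₗ Fin b))} (hφ : HasParity 0 φ)
    (hφ1 : star φ ⬝ᵥ φ = 1) :
    (dWaveSourceTorusTT' L tp U μ h).groundEnergy ≤
      ((Kx * Ky : ℕ) : ℝ) * (star φ ⬝ᵥ (dWaveSourceOpenBoxTT' a b tp U μ h *ᵥ φ)).re := by
  have hunit : star ((rectBlockPartition hLa hLb).prodFamily fun _ => φ) ⬝ᵥ
      ((rectBlockPartition hLa hLb).prodFamily fun _ => φ) = 1 := by
    rw [(rectBlockPartition hLa hLb).star_prodFamily_dotProduct_prodFamily]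
    exact Finset.prod_eq_one fun _ _ => hφ1
  have hle := Matrix.groundEnergy_le_rayleigh_holds (dWaveSourceTorusTT'_isHermitian L tp U μ h) _ hunit
  rw [expect_prodFamily_dWaveSourceTorusTT' hLa hLb haL hbL tp U μ h hφ hφ1] at hle
  rw [show ((Kx * Ky : ℕ) : ℂ) = (((Kx * Ky : ℕ) : ℝ) : ℂ) by norm_cast, Complex.re_ofReal_mul] at hle
  exact hle

/-- The same bound per site: `E₀(A^{tt'}_L) ≤ (Re⟨φ, A^{tt'}_C φ⟩ / (a b)) · L²`. [cite: Ruelle1969, §3.3] -/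
theorem groundEnergy_dWaveSourceTorusTT'_le_div_mul_sq [NeZero L] {Kx Ky : ℕ} (hLa : L = Kx * a)
    (hLb : L = Ky * b) (haL : a < L) (hbL : b < L) (tp U μ h : ℝ) {φ : Fock (Orb (Fin a ×ₗ Fin b))}
    (hφ : HasParity 0 φ) (hφ1 : star φ ⬝ᵥ φ = 1) :
    (dWaveSourceTorusTT' L tp U μ h).groundEnergy ≤
      (star φ ⬝ᵥ (dWaveSourceOpenBoxTT' a b tp U μ h *ᵥ φ)).re / ((a : ℝ) * b) * (L : ℝ) ^ 2 := by
  have ha : 0 < a := side_pos_of_eq hLa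
  have hb : 0 < b := side_pos_of_eq hLb
  have hle := groundEnergy_dWaveSourceTorusTT'_le_mul_expect_openBox hLa hLb haL hbL tp U μ h hφ hφ1
  have hL2 : ((L : ℝ)) ^ 2 = ((Kx * Ky : ℕ) : ℝ) * ((a : ℝ) * b) := by
    rw [sq]
    nth_rewrite 1 [hLa]
    rw [hLb]
    push_cast
    ring
  rw [hL2, div_mul_eq_mul_div, mul_comm ((star φ ⬝ᵥ _).re), mul_assoc, mul_div_assoc,
    mul_div_cancel_left₀ _ (by positivity : ((a : ℝ) * b) ≠ 0)]
  exact hle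

end Cut

/-! ### The rows at general `tp` -/

section Rows

variable {L a b q L₀ : ℕ}

/-- The sourced energy CEILING cell at general `tp` from an even unit vector of the open `t–t'` cluster:
`Re⟨φ, A^{tt'}_C φ⟩ ≤ e·(ab)` gives `SourcedTorusEnergyUpperRow L tp U μ h e`. [cite: Ruelle1969, §3.3] -/
theorem sourcedTorusEnergyUpperRow_of_clusterStateTT' [NeZero L] {Kx Ky : ℕ} (hLa : L = Kx * a)
    (hLb : L = Ky * b) (haL : a < L) (hbL : b < L) (tp U μ h : ℝ) {φ : Fock (Orb (Fin a ×ₗ Fin b))}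
    (hφ : HasParity 0 φ) (hφ1 : star φ ⬝ᵥ φ = 1) {e : ℚ}
    (he : (star φ ⬝ᵥ (dWaveSourceOpenBoxTT' a b tp U μ h *ᵥ φ)).re ≤ ((e : ℚ) : ℝ) * ((a : ℝ) * b)) :
    SourcedTorusEnergyUpperRow L tp U μ h e := by
  rw [SourcedTorusEnergyUpperRow.iff_groundEnergy_le]
  have ha : 0 < a := side_pos_of_eq hLa
  have hb : 0 < b := side_pos_of_eq hLb
  have hab : (0 : ℝ) < (a : ℝ) * b := by positivity
  refine (groundEnergy_dWaveSourceTorusTT'_le_div_mul_sq hLa hLb haL hbL tp U μ h hφ hφ1).trans ?_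
  exact mul_le_mul_of_nonneg_right ((div_le_iff₀ hab).2 he) (by positivity)

/-- **The uniform sourced energy CEILING row at general `tp`** (`a ∣ q`, `b ∣ q`, `a, b < L₀`).
[cite: Ruelle1969, §3.3] -/
theorem sourcedEnergyUpperRow_of_clusterStateTT' (hqa : a ∣ q) (hqb : b ∣ q) (hLa0 : a < L₀) (hLb0 : b < L₀)
    (tp U μ h : ℝ) {φ : Fock (Orb (Fin a ×ₗ Fin b))} (hφ : HasParity 0 φ) (hφ1 : star φ ⬝ᵥ φ = 1) {e : ℚ}
    (he : (star φ ⬝ᵥ (dWaveSourceOpenBoxTT' a b tp U μ h *ᵥ φ)).re ≤ ((e : ℚ) : ℝ) * ((a : ℝ) * b)) :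
    SourcedEnergyUpperRow tp U μ h q L₀ e := by
  intro L _ hL hqL
  obtain ⟨Kx, hKx⟩ := hqa.trans hqL
  obtain ⟨Ky, hKy⟩ := hqb.trans hqL
  exact sourcedTorusEnergyUpperRow_of_clusterStateTT' (by rw [hKx, mul_comm]) (by rw [hKy, mul_comm])
    (lt_of_lt_of_le hLa0 hL) (lt_of_lt_of_le hLb0 hL) tp U μ h hφ hφ1 he

/-- The uniform row at general `tp` from a cluster certificate in existential form. [cite: Ruelle1969, §3.3] -/
theorem sourcedEnergyUpperRow_of_exists_clusterStateTT' (hqa : a ∣ q) (hqb : b ∣ q) (hLa0 : a < L₀)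
    (hLb0 : b < L₀) (tp U μ h : ℝ) {e : ℚ}
    (hex : ∃ φ : Fock (Orb (Fin a ×ₗ Fin b)), HasParity 0 φ ∧ star φ ⬝ᵥ φ = 1 ∧
      (star φ ⬝ᵥ (dWaveSourceOpenBoxTT' a b tp U μ h *ᵥ φ)).re ≤ ((e : ℚ) : ℝ) * ((a : ℝ) * b)) :
    SourcedEnergyUpperRow tp U μ h q L₀ e := by
  obtain ⟨φ, hφ, hφ1, he⟩ := hex
  exact sourcedEnergyUpperRow_of_clusterStateTT' hqa hqb hLa0 hLb0 tp U μ h hφ hφ1 he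

/-- **Periodic trial rows at general `tp`** (the `hrows` shape of the TI bridge and of
`sourcedEnergyUpperRow_of_hrows`, REAL slots): `n = Re⟨φ, N_Cφ⟩/(ab)`, `e = Re⟨φ, A^{tt'}_C(μ,h)φ⟩/(ab)`.
[cite: Ruelle1969, §3.3] -/
theorem periodicTrialRows_of_clusterStateTT' (hqa : a ∣ q) (hqb : b ∣ q) (hLa0 : a < L₀) (hLb0 : b < L₀)
    (tp U μ h : ℝ) {φ : Fock (Orb (Fin a ×ₗ Fin b))} (hφ : HasParity 0 φ) (hφ1 : star φ ⬝ᵥ φ = 1) :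
    ∀ L : ℕ, q ∣ L → L₀ ≤ L → ∀ [NeZero L], ∃ ψ : Fock (Orb (FermionTorus 2 L)),
      star ψ ⬝ᵥ ψ = 1 ∧
        (expect totalNumber ψ).re = (expect totalNumber φ).re / ((a : ℝ) * b) * (L : ℝ) ^ 2 ∧
        (expect (dWaveSourceTorusTT' L tp U μ h) ψ).re =
          (expect (dWaveSourceOpenBoxTT' a b tp U μ h) φ).re / ((a : ℝ) * b) * (L : ℝ) ^ 2 := by
  intro L hqL hL _
  obtain ⟨Kx, hKx⟩ := hqa.trans hqL
  obtain ⟨Ky, hKy⟩ := hqb.trans hqL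
  have hLa : L = Kx * a := by rw [hKx, mul_comm]
  have hLb : L = Ky * b := by rw [hKy, mul_comm]
  have haL : a < L := lt_of_lt_of_le hLa0 hL
  have hbL : b < L := lt_of_lt_of_le hLb0 hL
  obtain ⟨h1, hN, -⟩ := trialRows_prodFamily hLa hLb haL hbL U μ h hφ hφ1
  have ha : 0 < a := side_pos_of_eq hLa
  have hb : 0 < b := side_pos_of_eq hLb
  have hab : ((a : ℝ) * b) ≠ 0 := by positivity
  have hL2 : ((L : ℝ)) ^ 2 = ((Kx * Ky : ℕ) : ℝ) * ((a : ℝ) * b) := by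
    rw [sq]
    nth_rewrite 1 [hLa]
    rw [hLb]
    push_cast
    ring
  have hcast : ((Kx * Ky : ℕ) : ℂ) = (((Kx * Ky : ℕ) : ℝ) : ℂ) := by norm_cast
  refine ⟨(rectBlockPartition hLa hLb).prodFamily fun _ => φ, h1, hN, ?_⟩
  unfold expect
  rw [expect_prodFamily_dWaveSourceTorusTT' hLa hLb haL hbL tp U μ h hφ hφ1, hcast, Complex.re_ofReal_mul, hL2]
  field_simp

/-- Periodic trial rows at general `tp`, RATIONAL slots (`μ = ((μ₀ : ℚ) : ℝ)`). [cite: Ruelle1969, §3.3] -/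
theorem periodicTrialRows_of_clusterStateTT'_rat (hqa : a ∣ q) (hqb : b ∣ q) (hLa0 : a < L₀) (hLb0 : b < L₀)
    (tp U h : ℝ) (μ₀ : ℚ) {φ : Fock (Orb (Fin a ×ₗ Fin b))} (hφ : HasParity 0 φ) (hφ1 : star φ ⬝ᵥ φ = 1)
    {n e : ℚ} (hn : (expect totalNumber φ).re = ((n : ℚ) : ℝ) * ((a : ℝ) * b))
    (he : (expect (dWaveSourceOpenBoxTT' a b tp U ((μ₀ : ℚ) : ℝ) h) φ).re = ((e : ℚ) : ℝ) * ((a : ℝ) * b)) :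
    ∀ L : ℕ, q ∣ L → L₀ ≤ L → ∀ [NeZero L], ∃ ψ : Fock (Orb (FermionTorus 2 L)),
      star ψ ⬝ᵥ ψ = 1 ∧ (expect totalNumber ψ).re = ((n : ℚ) : ℝ) * (L : ℝ) ^ 2 ∧
        (expect (dWaveSourceTorusTT' L tp U ((μ₀ : ℚ) : ℝ) h) ψ).re = ((e : ℚ) : ℝ) * (L : ℝ) ^ 2 := by
  intro L hqL hL _
  obtain ⟨ψ, h1, hN, hE⟩ :=
    periodicTrialRows_of_clusterStateTT' hqa hqb hLa0 hLb0 tp U ((μ₀ : ℚ) : ℝ) h hφ hφ1 L hqL hL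
  have hab : ((a : ℝ) * b) ≠ 0 := by
    have ha' : 0 < a := Nat.pos_of_ne_zero fun h0 => by
      rw [h0] at hqa; exact NeZero.ne L (Nat.eq_zero_of_zero_dvd (hqa.trans hqL))
    have hb' : 0 < b := Nat.pos_of_ne_zero fun h0 => by
      rw [h0] at hqb; exact NeZero.ne L (Nat.eq_zero_of_zero_dvd (hqb.trans hqL))
    positivity
  refine ⟨ψ, h1, ?_, ?_⟩
  · rw [hN, hn, mul_div_assoc, div_self hab, mul_one]
  · rw [hE, he, mul_div_assoc, div_self hab, mul_one]

end Rows

end Summit.Ventures.CertifiedManyBodySolver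

end
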